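import Summits.AtomisticToContinuum.HydrodynamicLimit.Theorems.StiffCollisionalRelaxationAprioriBoundsPartOneOfTails
import Summits.AtomisticToContinuum.HydrodynamicLimit.Theorems.StiffCollisionalRelaxationAprioriBoundsVelocityTailsOfGaussianVelocityTails
import Summits.AtomisticToContinuum.HydrodynamicLimit.Theorems.StiffCollisionalRelaxationAprioriBoundsVelocityLLNOfMaxwellianOneBody
import Summits.AtomisticToContinuum.HydrodynamicLimit.Theorems.StiffCollisionalRelaxationAprioriBoundsPartTwoOfKineticRangeControl
import Summits.AtomisticToContinuum.HydrodynamicLimit.Theses.StiffCollisionalRelaxation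
import Summits.AtomisticToContinuum.HydrodynamicLimit.Theses.CollisionIsometryCLT
import HarnessLib

/-!
# The a-priori crux reduced to three existing sibling items (line `Sketch`, cycle 5)

Supporting file of the line `Sketch` for the crux `AprioriBounds` (stmt-AtomisticToContinuum-14827;
`StiffCollisionalRelaxation.AprioriBounds` = `CollisionIsometryCLT.AprioriBoundsPreShock`), lead prover
`prover-line-stmt-AtomisticToContinuum-14827-c4-0`.

After reshape r7 the line's skeleton carries no private mathematical content: component (ii) of the crux is implied by the
crux `GermanoSplitLES.KineticRangeControl` (stmt-9201; landed glue `partTwo_of_kineticRangeControl`), and component (i) by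
an expected Gaussian velocity moment along the flow (the body of `SpeedCapSurgery.GaussianVelocityTails`, stmt-9633, =
Nachtergaele–Yau's II.1 / the barrier catalogue's `HighMomentumCutoff σ`) together with a fixed-time law of large numbers
for bounded velocity statistics (implied by `AnosovDiceHopf.MaxwellianOneBodyInBand`, stmt-17603, or by the retired
unguarded stmt-14290), chained by the landed glue
`stub_partOneOfTails`.  This file records the resulting REDUCTIONS as theorems:

* `partOne_of_tails_of_lln`: component (i) verbatim under the crux prefix from any producers of the two r7 statements;
* `aprioriBounds_of_KRC_GVT_MOBInBand :
    KineticRangeControl → GaussianVelocityTails → MaxwellianOneBodyInBand → AprioriBounds`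
  (and `…Unguarded` from the retired unguarded LLN, deprecated alias `aprioriBounds_of_KRC_GVT_MOB`);
* `aprioriBounds_of_KRC_HMC_MOBInBand` / `…Unguarded`: the same with `∃ σ₀ ∀ σ < σ₀, HighMomentumCutoff σ` in place
  of the route item;
* the `CollisionIsometryCLT.AprioriBoundsPreShock` twins (the two route decls are the same `Prop`).

All hypotheses are OPEN statements (items 9201, 9633, 17603 / retired 14290 = 4742; the barrier hypothesis is asserted nowhere): these are
implications, not closures.  No new definitions; axioms `propext`, `Classical.choice`, `Quot.sound`.

Maintenance note (full-build repair 2026-08-17, importer rebuild after p133748; no mathematics changed). The route repair of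
`AnosovDiceHopf` (rev 12, 2026-08-16T23:23:30Z, after the statement re-type p126922) RETIRED the decl
`AnosovDiceHopf.MaxwellianOneBody` (stmt-14290) in favour of the in-band `MaxwellianOneBodyInBand` (stmt-17603), so the four
reductions naming it stopped elaborating. As in the sibling dock file
`StiffCollisionalRelaxationAprioriBoundsVelocityLLNOfMaxwellianOneBody.lean` (p133748): each is re-keyed, statement otherwise
and proof unchanged, to the verbatim twin `AnosovRotorDice.MaxwellianOneBody` (stmt-4742 = stmt-14290 character for
character, kept file of the closed route `AnosovRotorDice`) under the suffix `Unguarded`, the landed names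
`aprioriBounds_of_KRC_GVT_MOB`, `aprioriBounds_of_KRC_HMC_MOB`, `aprioriBoundsPreShock_of_KRC_GVT_MOB`,
`aprioriBoundsPreShock_of_KRC_HMC_MOB` survive as deprecated aliases (append-only: deprecate, don't mutate), and the
`…InBand` twins record the same reductions from the LIVE item stmt-17603 through the landed dock
`stub_velocityLLN_of_maxwellianOneBodyInBand`. Still no definitions; axioms `propext`, `Classical.choice`, `Quot.sound`.
-/

noncomputable section

open MeasureTheory Filter Set Topology
open scoped ENNReal

namespace Summit.AtomisticToContinuum.HydrodynamicLimit.Theorems.AdiabatCeiling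

open Literature.MathematicalPhysics.KineticTheory Literature.Analysis.FluidPDE

/-- The truncated exponential `v ↦ e^{λ|v|²} ∧ K` is continuous and bounded by `|K|` in absolute value
(for `K ≤ 0` it is the constant `K`; for `K > 0` it lies in `(0, K]`). -/
theorem truncExp_continuous_bounded (lam K : ℝ) :
    Continuous (fun v : V3 => min (Real.exp (lam * ‖v‖ ^ 2)) K) ∧
      ∃ B : ℝ, ∀ v : V3, |min (Real.exp (lam * ‖v‖ ^ 2)) K| ≤ B := by
  refine ⟨((continuous_const.mul (continuous_norm.pow 2)).rexp).min continuous_const, |K|, fun v => ?_⟩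
  rcases le_total (Real.exp (lam * ‖v‖ ^ 2)) K with h | h
  · rw [min_eq_left h, abs_of_pos (Real.exp_pos _)]
    exact h.trans (le_abs_self K)
  · rw [min_eq_right h]

/-- Component (i) VERBATIM under the crux prefix (the cycle-1 `stub_partOne` signature) from ANY producers of the two r7
statements (hypotheses `h1` = the text of `stub_velocityTails`, `h2` = the text of `stub_velocityLLN`): the tail statement gives `c, C, N₀`; the LLN statement, applied to the bounded continuous velocity statistics
`ψ_K(v) = e^{(c/2)|v|²} ∧ K`, gives the fixed-time concentration; `stub_partOneOfTails` concludes with `λ := c/2`,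
`C_exp := t·C + 1`.  Thresholds: `σ₀ := min σ₁ (min σ₂ (1/2))`, `η₁ := min`. -/
theorem partOne_of_tails_of_lln
    (h1 :
      ∀ (a₀ θ₀ : T3 → ℝ) (u₀ : T3 → V3), Continuous a₀ → Continuous θ₀ → Continuous u₀ →
        (∀ x, 0 < a₀ x) → (∀ x, 0 < θ₀ x) →
        ∃ σ₀ : ℝ, 0 < σ₀ ∧ ∃ η₁ : ℝ, 0 < η₁ ∧ ∀ σ : ℝ, 0 < σ → σ < σ₀ →
          ∀ (T : ℝ) (ρ θ : ℝ → T3 → ℝ) (u : ℝ → T3 → V3), IsHardSphereEulerSolution σ T ρ u θ →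
          ∀ Φ : (N : ℕ) → HardSphereFlow (Torus.geometry (Fin 3)) (hsDiameter σ N) (N + 1),
            TendstoHydroFieldsAt (fun N => localGibbsLaw σ a₀ u₀ θ₀ N (Φ N)) Φ ρ u θ 0 →
            ∀ t : ℝ, 0 < t → t < T → (∀ s ∈ Icc 0 t, ∀ x, 2 * ρ s x * σ ^ 3 < η₁) →
              ∃ c : ℝ, 0 < c ∧ ∃ C : ℝ≥0∞, C < ⊤ ∧ ∃ N₀ : ℕ, ∀ N : ℕ, N₀ ≤ N → ∀ s ∈ Icc 0 t,
                ∫⁻ z, Literature.Barriers.AtomisticToContinuum.expVelocityMoment c ((Φ N).flow s z)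
                  ∂(localGibbsLaw σ a₀ u₀ θ₀ N (Φ N)) ≤ C)
    (h2 :
      ∀ (a₀ θ₀ : T3 → ℝ) (u₀ : T3 → V3), Continuous a₀ → Continuous θ₀ → Continuous u₀ →
        (∀ x, 0 < a₀ x) → (∀ x, 0 < θ₀ x) →
        ∃ σ₀ : ℝ, 0 < σ₀ ∧ ∃ η₁ : ℝ, 0 < η₁ ∧ ∀ σ : ℝ, 0 < σ → σ < σ₀ →
          ∀ (T : ℝ) (ρ θ : ℝ → T3 → ℝ) (u : ℝ → T3 → V3), IsHardSphereEulerSolution σ T ρ u θ →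
          ∀ Φ : (N : ℕ) → HardSphereFlow (Torus.geometry (Fin 3)) (hsDiameter σ N) (N + 1),
            TendstoHydroFieldsAt (fun N => localGibbsLaw σ a₀ u₀ θ₀ N (Φ N)) Φ ρ u θ 0 →
            ∀ t : ℝ, 0 < t → t < T → (∀ s ∈ Icc 0 t, ∀ x, 2 * ρ s x * σ ^ 3 < η₁) →
              ∀ ψ : V3 → ℝ, Continuous ψ → (∃ B : ℝ, ∀ v, |ψ v| ≤ B) → ∀ s ∈ Icc 0 t, ∃ m : ℝ,
                ∀ δ : ℝ, 0 < δ → Tendsto (fun N : ℕ => localGibbsLaw σ a₀ u₀ θ₀ N (Φ N)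
                  {z | δ < |(∫ y, ψ y.2 ∂(empiricalMeasure ((Φ N).flow s z))) - m|}) atTop (𝓝 0)) :
    ∀ (a₀ θ₀ : T3 → ℝ) (u₀ : T3 → V3), Continuous a₀ → Continuous θ₀ → Continuous u₀ →
      (∀ x, 0 < a₀ x) → (∀ x, 0 < θ₀ x) →
      ∃ σ₀ : ℝ, 0 < σ₀ ∧ ∃ η₁ : ℝ, 0 < η₁ ∧ ∀ σ : ℝ, 0 < σ → σ < σ₀ →
        ∀ (T : ℝ) (ρ θ : ℝ → T3 → ℝ) (u : ℝ → T3 → V3), IsHardSphereEulerSolution σ T ρ u θ →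
        ∀ Φ : (N : ℕ) → HardSphereFlow (Torus.geometry (Fin 3)) (hsDiameter σ N) (N + 1),
          TendstoHydroFieldsAt (fun N => localGibbsLaw σ a₀ u₀ θ₀ N (Φ N)) Φ ρ u θ 0 →
          ∀ t : ℝ, 0 < t → t < T → (∀ s ∈ Icc 0 t, ∀ x, 2 * ρ s x * σ ^ 3 < η₁) →
            ∃ lam Cexp : ℝ, 0 < lam ∧ Tendsto (fun N : ℕ => localGibbsLaw σ a₀ u₀ θ₀ N (Φ N)
              {z | Cexp < ∫ s in Icc 0 t, ∫ y, Real.exp (lam * ‖y.2‖ ^ 2)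
                ∂(empiricalMeasure ((Φ N).flow s z))}) atTop (𝓝 0) := by
  intro a₀ θ₀ u₀ ha hθ hu ha0 hθ0
  obtain ⟨σ₁, hσ₁, η₁', hη₁', H1⟩ := h1 a₀ θ₀ u₀ ha hθ hu ha0 hθ0
  obtain ⟨σ₂, hσ₂, η₂', hη₂', H2⟩ := h2 a₀ θ₀ u₀ ha hθ hu ha0 hθ0
  refine ⟨min σ₁ (min σ₂ (1 / 2)), lt_min hσ₁ (lt_min hσ₂ one_half_pos), min η₁' η₂', lt_min hη₁' hη₂',
    fun σ hσ hσlt T ρ θ u hsol Φ hLLN t ht htT hdil => ?_⟩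
  simp only [lt_min_iff] at hσlt hdil
  obtain ⟨hs1, hs2, hs3⟩ := hσlt
  obtain ⟨c, hc, C, hC, N₀, htails⟩ :=
    H1 σ hσ hs1 T ρ θ u hsol Φ hLLN t ht htT (fun s hs x => (hdil s hs x).1)
  have hlln : ∀ K : ℝ, ∀ s ∈ Icc 0 t, ∃ m : ℝ, ∀ δ : ℝ, 0 < δ →
      Tendsto (fun N : ℕ => localGibbsLaw σ a₀ u₀ θ₀ N (Φ N)
        {z | δ < |(∫ y, min (Real.exp (c / 2 * ‖y.2‖ ^ 2)) K ∂(empiricalMeasure ((Φ N).flow s z))) - m|})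
        atTop (𝓝 0) := fun K s hs =>
    H2 σ hσ hs2 T ρ θ u hsol Φ hLLN t ht htT (fun s hs x => (hdil s hs x).2)
      (fun v : V3 => min (Real.exp (c / 2 * ‖v‖ ^ 2)) K) (truncExp_continuous_bounded (c / 2) K).1
      (truncExp_continuous_bounded (c / 2) K).2 s hs
  exact ⟨c / 2, t * C.toReal + 1, half_pos hc,
    stub_partOneOfTails a₀ θ₀ u₀ ha hθ hu ha0 hθ0 σ hσ hs3.le Φ t c C N₀ ht hc hC htails hlln⟩

/-- **The crux from three existing sibling items** (REGISTERED reduction): `KineticRangeControl` (stmt-9201) gives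
component (ii) (`partTwo_of_kineticRangeControl`), `GaussianVelocityTails` (stmt-9633) and `MaxwellianOneBody` (stmt-14290) give
the two r7 contents of component (i) (`stub_velocityTails_of_gaussianVelocityTails`, `stub_velocityLLN_of_maxwellianOneBody`),
chained by `partOne_of_tails_of_lln`; thresholds `σ₀, η₁ := min`.
Re-keyed 2026-08-17 (full-build repair) to the verbatim twin `AnosovRotorDice.MaxwellianOneBody`
(stmt-AtomisticToContinuum-4742 = the retired stmt-14290, character for character) of the retired route decl
`AnosovDiceHopf.MaxwellianOneBody`; statement otherwise and proof unchanged (dock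
`stub_velocityLLN_of_maxwellianOneBodyUnguarded`). -/
theorem aprioriBounds_of_KRC_GVT_MOBUnguarded :
    Summit.AtomisticToContinuum.HydrodynamicLimit.Theses.GermanoSplitLES.KineticRangeControl →
    Summit.AtomisticToContinuum.HydrodynamicLimit.Theses.SpeedCapSurgery.GaussianVelocityTails →
    Summit.AtomisticToContinuum.HydrodynamicLimit.Theses.AnosovRotorDice.MaxwellianOneBody →
    Summit.AtomisticToContinuum.HydrodynamicLimit.Theses.StiffCollisionalRelaxation.AprioriBounds := by
  intro hKRC hGVT hMOB a₀ θ₀ u₀ ha hθ hu ha0 hθ0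
  obtain ⟨σ₁, hσ₁, η₁', hη₁', h1⟩ :=
    partOne_of_tails_of_lln (stub_velocityTails_of_gaussianVelocityTails hGVT)
      (stub_velocityLLN_of_maxwellianOneBodyUnguarded hMOB) a₀ θ₀ u₀ ha hθ hu ha0 hθ0
  obtain ⟨σ₂, hσ₂, η₂', hη₂', h2⟩ := partTwo_of_kineticRangeControl hKRC a₀ θ₀ u₀ ha hθ hu ha0 hθ0
  refine ⟨min σ₁ σ₂, lt_min hσ₁ hσ₂, min η₁' η₂', lt_min hη₁' hη₂', ?_⟩
  intro σ hσ hσlt T ρ θ u hsol Φ hLLN t ht htT hdil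
  simp only [lt_min_iff] at hσlt hdil
  exact ⟨h1 σ hσ hσlt.1 T ρ θ u hsol Φ hLLN t ht htT (fun s hs x => (hdil s hs x).1),
    h2 σ hσ hσlt.2 T ρ θ u hsol Φ hLLN t ht htT (fun s hs x => (hdil s hs x).2)⟩

/-- Deprecated spelling of `aprioriBounds_of_KRC_GVT_MOBUnguarded`: the landed reduction read
`… → AnosovDiceHopf.MaxwellianOneBody → …` against the route item stmt-AtomisticToContinuum-14290, retired by the
`AnosovDiceHopf` repair of 2026-08-16T23:23:30Z (rev 12); the name now points at the same proof against the verbatim twin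
`AnosovRotorDice.MaxwellianOneBody` (append-only: deprecate, don't mutate).
New code: `aprioriBounds_of_KRC_GVT_MOBInBand`. -/
@[deprecated aprioriBounds_of_KRC_GVT_MOBUnguarded (since := "2026-08-17")]
alias aprioriBounds_of_KRC_GVT_MOB := aprioriBounds_of_KRC_GVT_MOBUnguarded

/-- **Live-item twin of `aprioriBounds_of_KRC_GVT_MOBUnguarded`**: the same reduction with the LIVE route item
`AnosovDiceHopf.MaxwellianOneBodyInBand` (stmt-AtomisticToContinuum-17603, the packing-guarded one-body local-Maxwellian
LLN that replaced stmt-14290 at the `AnosovDiceHopf` repair of 2026-08-16T23:23Z) as the LLN producer, through the landed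
dock `stub_velocityLLN_of_maxwellianOneBodyInBand` (same output statement, so the same proof text). -/
theorem aprioriBounds_of_KRC_GVT_MOBInBand :
    Summit.AtomisticToContinuum.HydrodynamicLimit.Theses.GermanoSplitLES.KineticRangeControl →
    Summit.AtomisticToContinuum.HydrodynamicLimit.Theses.SpeedCapSurgery.GaussianVelocityTails →
    Summit.AtomisticToContinuum.HydrodynamicLimit.Theses.AnosovDiceHopf.MaxwellianOneBodyInBand →
    Summit.AtomisticToContinuum.HydrodynamicLimit.Theses.StiffCollisionalRelaxation.AprioriBounds := by
  intro hKRC hGVT hMOB a₀ θ₀ u₀ ha hθ hu ha0 hθ0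
  obtain ⟨σ₁, hσ₁, η₁', hη₁', h1⟩ :=
    partOne_of_tails_of_lln (stub_velocityTails_of_gaussianVelocityTails hGVT)
      (stub_velocityLLN_of_maxwellianOneBodyInBand hMOB) a₀ θ₀ u₀ ha hθ hu ha0 hθ0
  obtain ⟨σ₂, hσ₂, η₂', hη₂', h2⟩ := partTwo_of_kineticRangeControl hKRC a₀ θ₀ u₀ ha hθ hu ha0 hθ0
  refine ⟨min σ₁ σ₂, lt_min hσ₁ hσ₂, min η₁' η₂', lt_min hη₁' hη₂', ?_⟩
  intro σ hσ hσlt T ρ θ u hsol Φ hLLN t ht htT hdil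
  simp only [lt_min_iff] at hσlt hdil
  exact ⟨h1 σ hσ hσlt.1 T ρ θ u hsol Φ hLLN t ht htT (fun s hs x => (hdil s hs x).1),
    h2 σ hσ hσlt.2 T ρ θ u hsol Φ hLLN t ht htT (fun s hs x => (hdil s hs x).2)⟩

/-- The same reduction with the barrier catalogue's open hypothesis `HighMomentumCutoff σ` (for all small `σ`;
Nachtergaele–Yau II.1 transcribed to hard spheres, `Literature/Barriers/AtomisticToContinuum/HighMomentumCutoff.lean`) in
place of the route item `GaussianVelocityTails` (landed dock `velocityTails_of_highMomentumCutoff`).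
Re-keyed 2026-08-17 (full-build repair) to the verbatim twin `AnosovRotorDice.MaxwellianOneBody`
(stmt-AtomisticToContinuum-4742 = the retired stmt-14290, character for character) of the retired route decl
`AnosovDiceHopf.MaxwellianOneBody`; statement otherwise and proof unchanged (dock
`stub_velocityLLN_of_maxwellianOneBodyUnguarded`). -/
theorem aprioriBounds_of_KRC_HMC_MOBUnguarded :
    Summit.AtomisticToContinuum.HydrodynamicLimit.Theses.GermanoSplitLES.KineticRangeControl →
    (∃ σ₀ : ℝ, 0 < σ₀ ∧ ∀ σ : ℝ, 0 < σ → σ < σ₀ → Literature.Barriers.AtomisticToContinuum.HighMomentumCutoff σ) →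
    Summit.AtomisticToContinuum.HydrodynamicLimit.Theses.AnosovRotorDice.MaxwellianOneBody →
    Summit.AtomisticToContinuum.HydrodynamicLimit.Theses.StiffCollisionalRelaxation.AprioriBounds := by
  intro hKRC hHMC hMOB a₀ θ₀ u₀ ha hθ hu ha0 hθ0
  obtain ⟨σ₁, hσ₁, η₁', hη₁', h1⟩ :=
    partOne_of_tails_of_lln (velocityTails_of_highMomentumCutoff hHMC)
      (stub_velocityLLN_of_maxwellianOneBodyUnguarded hMOB) a₀ θ₀ u₀ ha hθ hu ha0 hθ0
  obtain ⟨σ₂, hσ₂, η₂', hη₂', h2⟩ := partTwo_of_kineticRangeControl hKRC a₀ θ₀ u₀ ha hθ hu ha0 hθ0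
  refine ⟨min σ₁ σ₂, lt_min hσ₁ hσ₂, min η₁' η₂', lt_min hη₁' hη₂', ?_⟩
  intro σ hσ hσlt T ρ θ u hsol Φ hLLN t ht htT hdil
  simp only [lt_min_iff] at hσlt hdil
  exact ⟨h1 σ hσ hσlt.1 T ρ θ u hsol Φ hLLN t ht htT (fun s hs x => (hdil s hs x).1),
    h2 σ hσ hσlt.2 T ρ θ u hsol Φ hLLN t ht htT (fun s hs x => (hdil s hs x).2)⟩

/-- Deprecated spelling of `aprioriBounds_of_KRC_HMC_MOBUnguarded`: the landed reduction read
`… → AnosovDiceHopf.MaxwellianOneBody → …` against the route item stmt-AtomisticToContinuum-14290, retired by the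
`AnosovDiceHopf` repair of 2026-08-16T23:23:30Z (rev 12); the name now points at the same proof against the verbatim twin
`AnosovRotorDice.MaxwellianOneBody` (append-only: deprecate, don't mutate).
New code: `aprioriBounds_of_KRC_HMC_MOBInBand`. -/
@[deprecated aprioriBounds_of_KRC_HMC_MOBUnguarded (since := "2026-08-17")]
alias aprioriBounds_of_KRC_HMC_MOB := aprioriBounds_of_KRC_HMC_MOBUnguarded

/-- **Live-item twin of `aprioriBounds_of_KRC_HMC_MOBUnguarded`**: the same reduction with the LIVE route item
`AnosovDiceHopf.MaxwellianOneBodyInBand` (stmt-AtomisticToContinuum-17603, the packing-guarded one-body local-Maxwellian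
LLN that replaced stmt-14290 at the `AnosovDiceHopf` repair of 2026-08-16T23:23Z) as the LLN producer, through the landed
dock `stub_velocityLLN_of_maxwellianOneBodyInBand` (same output statement, so the same proof text). -/
theorem aprioriBounds_of_KRC_HMC_MOBInBand :
    Summit.AtomisticToContinuum.HydrodynamicLimit.Theses.GermanoSplitLES.KineticRangeControl →
    (∃ σ₀ : ℝ, 0 < σ₀ ∧ ∀ σ : ℝ, 0 < σ → σ < σ₀ → Literature.Barriers.AtomisticToContinuum.HighMomentumCutoff σ) →
    Summit.AtomisticToContinuum.HydrodynamicLimit.Theses.AnosovDiceHopf.MaxwellianOneBodyInBand →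
    Summit.AtomisticToContinuum.HydrodynamicLimit.Theses.StiffCollisionalRelaxation.AprioriBounds := by
  intro hKRC hHMC hMOB a₀ θ₀ u₀ ha hθ hu ha0 hθ0
  obtain ⟨σ₁, hσ₁, η₁', hη₁', h1⟩ :=
    partOne_of_tails_of_lln (velocityTails_of_highMomentumCutoff hHMC)
      (stub_velocityLLN_of_maxwellianOneBodyInBand hMOB) a₀ θ₀ u₀ ha hθ hu ha0 hθ0
  obtain ⟨σ₂, hσ₂, η₂', hη₂', h2⟩ := partTwo_of_kineticRangeControl hKRC a₀ θ₀ u₀ ha hθ hu ha0 hθ0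
  refine ⟨min σ₁ σ₂, lt_min hσ₁ hσ₂, min η₁' η₂', lt_min hη₁' hη₂', ?_⟩
  intro σ hσ hσlt T ρ θ u hsol Φ hLLN t ht htT hdil
  simp only [lt_min_iff] at hσlt hdil
  exact ⟨h1 σ hσ hσlt.1 T ρ θ u hsol Φ hLLN t ht htT (fun s hs x => (hdil s hs x).1),
    h2 σ hσ hσlt.2 T ρ θ u hsol Φ hLLN t ht htT (fun s hs x => (hdil s hs x).2)⟩

/-- The `CollisionIsometryCLT` twin of `aprioriBounds_of_KRC_GVT_MOB` (the two route decls are the same `Prop`).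
Re-keyed 2026-08-17 (full-build repair) to the verbatim twin `AnosovRotorDice.MaxwellianOneBody`
(stmt-AtomisticToContinuum-4742 = the retired stmt-14290, character for character) of the retired route decl
`AnosovDiceHopf.MaxwellianOneBody`; statement otherwise and proof unchanged (dock
`stub_velocityLLN_of_maxwellianOneBodyUnguarded`). -/
theorem aprioriBoundsPreShock_of_KRC_GVT_MOBUnguarded :
    Summit.AtomisticToContinuum.HydrodynamicLimit.Theses.GermanoSplitLES.KineticRangeControl →
    Summit.AtomisticToContinuum.HydrodynamicLimit.Theses.SpeedCapSurgery.GaussianVelocityTails →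
    Summit.AtomisticToContinuum.HydrodynamicLimit.Theses.AnosovRotorDice.MaxwellianOneBody →
    Summit.AtomisticToContinuum.HydrodynamicLimit.Theses.CollisionIsometryCLT.AprioriBoundsPreShock :=
  aprioriBounds_of_KRC_GVT_MOBUnguarded

/-- Deprecated spelling of `aprioriBoundsPreShock_of_KRC_GVT_MOBUnguarded`: the landed reduction read
`… → AnosovDiceHopf.MaxwellianOneBody → …` against the route item stmt-AtomisticToContinuum-14290, retired by the
`AnosovDiceHopf` repair of 2026-08-16T23:23:30Z (rev 12); the name now points at the same proof against the verbatim twin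
`AnosovRotorDice.MaxwellianOneBody` (append-only: deprecate, don't mutate).
New code: `aprioriBoundsPreShock_of_KRC_GVT_MOBInBand`. -/
@[deprecated aprioriBoundsPreShock_of_KRC_GVT_MOBUnguarded (since := "2026-08-17")]
alias aprioriBoundsPreShock_of_KRC_GVT_MOB := aprioriBoundsPreShock_of_KRC_GVT_MOBUnguarded

/-- **Live-item twin of `aprioriBoundsPreShock_of_KRC_GVT_MOBUnguarded`**: the same reduction with the LIVE route item
`AnosovDiceHopf.MaxwellianOneBodyInBand` (stmt-AtomisticToContinuum-17603, the packing-guarded one-body local-Maxwellian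
LLN that replaced stmt-14290 at the `AnosovDiceHopf` repair of 2026-08-16T23:23Z) as the LLN producer, through the landed
dock `stub_velocityLLN_of_maxwellianOneBodyInBand` (same output statement, so the same proof text). -/
theorem aprioriBoundsPreShock_of_KRC_GVT_MOBInBand :
    Summit.AtomisticToContinuum.HydrodynamicLimit.Theses.GermanoSplitLES.KineticRangeControl →
    Summit.AtomisticToContinuum.HydrodynamicLimit.Theses.SpeedCapSurgery.GaussianVelocityTails →
    Summit.AtomisticToContinuum.HydrodynamicLimit.Theses.AnosovDiceHopf.MaxwellianOneBodyInBand →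
    Summit.AtomisticToContinuum.HydrodynamicLimit.Theses.CollisionIsometryCLT.AprioriBoundsPreShock :=
  aprioriBounds_of_KRC_GVT_MOBInBand

/-- The `CollisionIsometryCLT` twin of `aprioriBounds_of_KRC_HMC_MOB`.
Re-keyed 2026-08-17 (full-build repair) to the verbatim twin `AnosovRotorDice.MaxwellianOneBody`
(stmt-AtomisticToContinuum-4742 = the retired stmt-14290, character for character) of the retired route decl
`AnosovDiceHopf.MaxwellianOneBody`; statement otherwise and proof unchanged (dock
`stub_velocityLLN_of_maxwellianOneBodyUnguarded`). -/
theorem aprioriBoundsPreShock_of_KRC_HMC_MOBUnguarded :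
    Summit.AtomisticToContinuum.HydrodynamicLimit.Theses.GermanoSplitLES.KineticRangeControl →
    (∃ σ₀ : ℝ, 0 < σ₀ ∧ ∀ σ : ℝ, 0 < σ → σ < σ₀ → Literature.Barriers.AtomisticToContinuum.HighMomentumCutoff σ) →
    Summit.AtomisticToContinuum.HydrodynamicLimit.Theses.AnosovRotorDice.MaxwellianOneBody →
    Summit.AtomisticToContinuum.HydrodynamicLimit.Theses.CollisionIsometryCLT.AprioriBoundsPreShock :=
  aprioriBounds_of_KRC_HMC_MOBUnguarded

/-- Deprecated spelling of `aprioriBoundsPreShock_of_KRC_HMC_MOBUnguarded`: the landed reduction read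
`… → AnosovDiceHopf.MaxwellianOneBody → …` against the route item stmt-AtomisticToContinuum-14290, retired by the
`AnosovDiceHopf` repair of 2026-08-16T23:23:30Z (rev 12); the name now points at the same proof against the verbatim twin
`AnosovRotorDice.MaxwellianOneBody` (append-only: deprecate, don't mutate).
New code: `aprioriBoundsPreShock_of_KRC_HMC_MOBInBand`. -/
@[deprecated aprioriBoundsPreShock_of_KRC_HMC_MOBUnguarded (since := "2026-08-17")]
alias aprioriBoundsPreShock_of_KRC_HMC_MOB := aprioriBoundsPreShock_of_KRC_HMC_MOBUnguarded

/-- **Live-item twin of `aprioriBoundsPreShock_of_KRC_HMC_MOBUnguarded`**: the same reduction with the LIVE route item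
`AnosovDiceHopf.MaxwellianOneBodyInBand` (stmt-AtomisticToContinuum-17603, the packing-guarded one-body local-Maxwellian
LLN that replaced stmt-14290 at the `AnosovDiceHopf` repair of 2026-08-16T23:23Z) as the LLN producer, through the landed
dock `stub_velocityLLN_of_maxwellianOneBodyInBand` (same output statement, so the same proof text). -/
theorem aprioriBoundsPreShock_of_KRC_HMC_MOBInBand :
    Summit.AtomisticToContinuum.HydrodynamicLimit.Theses.GermanoSplitLES.KineticRangeControl →
    (∃ σ₀ : ℝ, 0 < σ₀ ∧ ∀ σ : ℝ, 0 < σ → σ < σ₀ → Literature.Barriers.AtomisticToContinuum.HighMomentumCutoff σ) →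
    Summit.AtomisticToContinuum.HydrodynamicLimit.Theses.AnosovDiceHopf.MaxwellianOneBodyInBand →
    Summit.AtomisticToContinuum.HydrodynamicLimit.Theses.CollisionIsometryCLT.AprioriBoundsPreShock :=
  aprioriBounds_of_KRC_HMC_MOBInBand

end Summit.AtomisticToContinuum.HydrodynamicLimit.Theorems.AdiabatCeiling
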